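import Summits.AtomisticToContinuum.BoseEinsteinCondensation.Theorems.BECHardSphereReductionHardSphereBECStubSmallRatioOf
import HarnessLib

/-!
# Route `BECHardSphereReduction`, crux `HardSphereBEC` (stmt-AtomisticToContinuum-11885),
# line `registered` (`Lines/birth.lean`): the registered stub `stub_smallRatioMul_of`

Supports (does not close) stmt-AtomisticToContinuum-11885; stub `stub_smallRatioMul_of` (S6') of
the birth line, the BAIRE UNIFORMISATION OF THE DILATION RATIO WITH CONSTANTS AND THRESHOLDS
(the `K(a)`-and-`N₀(a)` version of the landed `stub_smallRatio_of`).

Write `cn(N, L)` for the ground-state condensate number of `N` unit hard spheres in the Dirichlet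
box of side `L` (`condensateNumber HS₁ N L`, `HS₁ = Set.indicator (Set.Iic 1) ⊤`).

**Statement.** Assume
* (one-sided Baire, S5) countably many sets covering an open interval, each closed inside it under
  limits of its points from the left, cannot all miss every nondegenerate closed sub-interval;
* (left lower-semicontinuity, conclusion of S4) for all `N`, `x > 0`, `C`: if boxes `x' < x`
  arbitrarily close to `x` have `cn(N, x') ≤ C`, then `cn(N, x) ≤ C`;
* (per-ratio RETENTION, S2) for ratios `a` in some open interval `(lo, hi) ⊂ (0, 1)` there are a
  threshold `N₀(a)`, a dilute guard `η₀(a) > 0` and a factor `K(a) > 0` with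
  `cn(N, L) ≤ K(a) · cn(N, L/a)` whenever `N ≥ N₀(a)` and `N ≤ η₀(a) L³`.
Then there are `n : ℕ` and `a₀ > 0` such that every ratio `a ∈ (0, a₀]` has a factor `K > 0`
with `cn(N, aM) ≤ K · cn(N, M)` for all `N ≥ n` and all `M` with `(n+1)·N < (aM)³`
(UNIFORM small-ratio retention).

**Proof.** Fold threshold, guard and factor into ONE index:
`A n := {a | ∀ N M, n ≤ N → (n+1)N < (aM)³ → cn(N, aM) ≤ n · cn(N, M)}`.
* Cover: S2 at `a ∈ (lo, hi)` with `n ≥ N₀(a)`, `1/(n+1) < η₀(a)`, `K(a) ≤ n` gives `a ∈ A n`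
  (box `L := aM`, `L/a = M`).
* Left closure: `A n` is closed from the left inside `(lo, hi)` by left lower-semicontinuity at
  `x := aM` and level `C := n · cn(N, M)` (the guard forces `M > 0`; the strict guard persists
  for ratios `b < a` close to `a` by continuity of `b ↦ (bM)³`).
* Baire (S5) gives `[a₁, a₂] ⊆ A n` with `0 < lo ≤ a₁ < a₂ ≤ hi < 1`.
* Powers: by induction `cn(N, bᵏ⁺¹M) ≤ nᵏ⁺¹ · cn(N, M)` under `N ≥ n`, `(n+1)N < (bᵏ⁺¹M)³` for
  `b ∈ [a₁, a₂]` (the boxes only grow along the chain, so the guard persists; factors multiply).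
* Roots (`SmallRatio.exists_root`, landed): every `a ∈ (0, a₀]`,
  `a₀ := exp (log a₁ · log a₂ / (log a₁ - log a₂))`, is `bᵏ⁺¹` with `b ∈ [a₁, a₂]`; take
  `K(a) := nᵏ⁺¹ + 1`.

The whole argument is elementary real analysis about an ARBITRARY function `cn : ℕ → ℝ → ℝ≥0∞`;
the helper lemmas (`SmallRatioMul.*`) are stated in that generality and the registered stub is the
instance `cn := condensateNumber HS₁`.  Mathlib only.  [folklore]
-/

namespace Summit.AtomisticToContinuum.BoseEinsteinCondensation.Cruxes.HardSphereBEC.Birth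

namespace SmallRatioMul

open Filter Topology SmallRatio

/-- A real bound `K ≤ n` by a natural number transfers to `ℝ≥0∞`: `ofReal K ≤ n`. [folklore] -/
theorem ofReal_le_natCast {K : ℝ} {n : ℕ} (h : K ≤ n) : ENNReal.ofReal K ≤ (n : ENNReal) :=
  calc ENNReal.ofReal K ≤ ENNReal.ofReal (n : ℝ) := ENNReal.ofReal_le_ofReal h
    _ = n := ENNReal.ofReal_natCast n

/-- The power `nᵏ` in `ℝ≥0∞` is dominated by `ofReal (nᵏ + 1)` (a positive real factor, also when
`n = 0`). [folklore] -/
theorem natCast_pow_le_ofReal (n k : ℕ) :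
    (n : ENNReal) ^ k ≤ ENNReal.ofReal ((n : ℝ) ^ k + 1) :=
  calc (n : ENNReal) ^ k = ENNReal.ofReal ((n : ℝ) ^ k) := by
        rw [ENNReal.ofReal_pow (Nat.cast_nonneg n), ENNReal.ofReal_natCast]
    _ ≤ ENNReal.ofReal ((n : ℝ) ^ k + 1) :=
        ENNReal.ofReal_le_ofReal (le_add_of_nonneg_right zero_le_one)

/-- **Cover.** Per-ratio retention at one ratio `a > 0` with threshold `N₀`, guard `η₀ > 0` and
factor `K` puts `a` in `A n := {a | ∀ N M, n ≤ N → (n+1)N < (aM)³ → cn(N, aM) ≤ n · cn(N, M)}`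
as soon as `n ≥ N₀`, `1/(n+1) < η₀` and `K ≤ n` (box `L := aM`, `L/a = M`). [folklore] -/
theorem cover (cn : ℕ → ℝ → ENNReal) {a η₀ K : ℝ} {N₀ : ℕ} (ha : 0 < a) (hη₀ : 0 < η₀)
    (hret : ∀ (N : ℕ) (L : ℝ), N₀ ≤ N → (N : ℝ) ≤ η₀ * L ^ 3 →
      cn N L ≤ ENNReal.ofReal K * cn N (L / a)) :
    ∃ n : ℕ, ∀ (N : ℕ) (M : ℝ), n ≤ N → ((n : ℝ) + 1) * N < (a * M) ^ 3 →
      cn N (a * M) ≤ (n : ENNReal) * cn N M := by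
  obtain ⟨n₁, hn₁⟩ := exists_nat_one_div_lt hη₀
  refine ⟨max N₀ (max n₁ ⌈K⌉₊), fun N M hnN hg => ?_⟩
  set n := max N₀ (max n₁ ⌈K⌉₊) with hn_def
  have hnN₀ : N₀ ≤ n := le_max_left _ _
  have hn₁n : n₁ ≤ n := (le_max_left _ _).trans (le_max_right _ _)
  have hKn : K ≤ n :=
    (Nat.le_ceil K).trans (by exact_mod_cast (le_max_right _ _).trans (le_max_right _ _))
  have hL3 : 0 < (a * M) ^ 3 := lt_of_le_of_lt (by positivity) hg
  have hn1 : (0 : ℝ) < (n : ℝ) + 1 := by positivity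
  have hn : 1 / ((n : ℝ) + 1) < η₀ := by
    refine lt_of_le_of_lt (one_div_le_one_div_of_le (by positivity) ?_) hn₁
    exact_mod_cast Nat.succ_le_succ hn₁n
  have hN : (N : ℝ) ≤ η₀ * (a * M) ^ 3 := by
    have h1 : (N : ℝ) < (a * M) ^ 3 / ((n : ℝ) + 1) := by
      rw [lt_div_iff₀ hn1]; linarith
    have h2 : (a * M) ^ 3 / ((n : ℝ) + 1) ≤ η₀ * (a * M) ^ 3 := by
      rw [div_eq_mul_one_div, mul_comm]
      exact mul_le_mul_of_nonneg_right hn.le hL3.le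
    linarith
  have h := hret N (a * M) (hnN₀.trans hnN) hN
  rw [mul_div_cancel_left₀ M ha.ne'] at h
  exact h.trans (mul_le_mul_left (ofReal_le_natCast hKn) _)

/-- **Left closure.** If `L ↦ cn(N, L)` is left lower-semicontinuous (sublevel sets closed under
approach from the left at every `x > 0`), then `A n` is closed under limits from the left at every
ratio `a > 0`: the guard forces `M > 0`, the strict guard `(n+1)N < (bM)³` persists for `b < a`
close to `a`, and `b ∈ A n` gives `cn(N, bM) ≤ n · cn(N, M)` with `bM ↑ aM`, so left
lower-semicontinuity at the level `C := n · cn(N, M)` applies. [folklore] -/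
theorem leftClosed (cn : ℕ → ℝ → ENNReal)
    (hLsc : ∀ (N : ℕ) (x : ℝ) (C : ENNReal), 0 < x →
      (∀ ε : ℝ, 0 < ε → ∃ x' : ℝ, x - ε < x' ∧ x' < x ∧ cn N x' ≤ C) → cn N x ≤ C)
    (n : ℕ) {a : ℝ} (ha : 0 < a)
    (hleft : ∀ ε : ℝ, 0 < ε → ∃ b : ℝ, a - ε < b ∧ b < a ∧
      ∀ (N : ℕ) (M : ℝ), n ≤ N → ((n : ℝ) + 1) * N < (b * M) ^ 3 →
        cn N (b * M) ≤ (n : ENNReal) * cn N M) :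
    ∀ (N : ℕ) (M : ℝ), n ≤ N → ((n : ℝ) + 1) * N < (a * M) ^ 3 →
      cn N (a * M) ≤ (n : ENNReal) * cn N M := by
  intro N M hnN hg
  have hM : 0 < M := pos_of_guard ha hg
  refine hLsc N (a * M) ((n : ENNReal) * cn N M) (mul_pos ha hM) fun ε' hε' => ?_
  -- the strict guard persists for ratios `b` near `a`
  have hcont : ContinuousAt (fun b : ℝ => (b * M) ^ 3) a :=
    ((continuous_id.mul continuous_const).pow 3).continuousAt
  have hev : ∀ᶠ b in 𝓝 a, ((n : ℝ) + 1) * N < (b * M) ^ 3 :=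
    Filter.Tendsto.eventually_const_lt hg hcont
  obtain ⟨ε₁, hε₁, hguard⟩ := Metric.eventually_nhds_iff.1 hev
  obtain ⟨b, hab, hba, hbA⟩ := hleft (min ε₁ (ε' / M)) (lt_min hε₁ (div_pos hε' hM))
  have hab₁ : a - b < ε₁ := by
    have := min_le_left ε₁ (ε' / M); linarith
  have hab₂ : a - b < ε' / M := by
    have := min_le_right ε₁ (ε' / M); linarith
  have hdist : dist b a < ε₁ := by
    rw [Real.dist_eq, abs_sub_comm, abs_of_pos (by linarith)]
    exact hab₁
  refine ⟨b * M, ?_, ?_, hbA N M hnN (hguard hdist)⟩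
  · have : (a - b) * M < ε' := by rwa [← lt_div_iff₀ hM]
    nlinarith
  · exact mul_lt_mul_of_pos_right hba hM

/-- **Powers.** If every ratio `b ∈ [a₁, a₂]` (`0 < a₁`, `a₂ ≤ 1`) lies in `A n`, then every
power `b^(k+1)` retains with factor `n^(k+1)`: along the chain `b^(k+1)M, b^k M, …, bM, M` the
boxes only grow, so the strict guard `(n+1)N < (·)³` persists from the smallest box to all the
others, and the factors `n` multiply. [folklore] -/
theorem pow_chain (cn : ℕ → ℝ → ENNReal) (n : ℕ) {a₁ a₂ : ℝ} (h₁ : 0 < a₁) (h₂ : a₂ ≤ 1)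
    (hA : ∀ b : ℝ, a₁ ≤ b → b ≤ a₂ →
      ∀ (N : ℕ) (M : ℝ), n ≤ N → ((n : ℝ) + 1) * N < (b * M) ^ 3 →
        cn N (b * M) ≤ (n : ENNReal) * cn N M) :
    ∀ (k : ℕ) (b : ℝ), a₁ ≤ b → b ≤ a₂ →
      ∀ (N : ℕ) (M : ℝ), n ≤ N → ((n : ℝ) + 1) * N < (b ^ (k + 1) * M) ^ 3 →
        cn N (b ^ (k + 1) * M) ≤ (n : ENNReal) ^ (k + 1) * cn N M := by
  intro k
  induction k with
  | zero =>
    intro b hb₁ hb₂ N M hnN hg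
    simp only [zero_add, pow_one] at hg ⊢
    exact hA b hb₁ hb₂ N M hnN hg
  | succ k ih =>
    intro b hb₁ hb₂ N M hnN hg
    have hb : 0 < b := lt_of_lt_of_le h₁ hb₁
    have hb1 : b ≤ 1 := hb₂.trans h₂
    have hM : 0 < M := pos_of_guard (pow_pos hb _) hg
    have hsplit : b ^ (k + 1 + 1) * M = b ^ (k + 1) * (b * M) := by ring
    -- the smaller box `b^(k+2) M` versus the intermediate box `b M`
    have hstep₁ : cn N (b ^ (k + 1) * (b * M)) ≤ (n : ENNReal) ^ (k + 1) * cn N (b * M) :=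
      ih b hb₁ hb₂ N (b * M) hnN (by rwa [← hsplit])
    -- the guard persists for the larger box `b M`
    have hle : b ^ (k + 1 + 1) * M ≤ b * M :=
      mul_le_mul_of_nonneg_right (pow_le_of_le_one hb.le hb1 (Nat.succ_ne_zero _)) hM.le
    have hg' : ((n : ℝ) + 1) * N < (b * M) ^ 3 :=
      lt_of_lt_of_le hg (pow_le_pow_left₀ (by positivity) hle 3)
    have hstep₂ : cn N (b * M) ≤ (n : ENNReal) * cn N M := hA b hb₁ hb₂ N M hnN hg'
    calc cn N (b ^ (k + 1 + 1) * M) = cn N (b ^ (k + 1) * (b * M)) := by rw [hsplit]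
      _ ≤ (n : ENNReal) ^ (k + 1) * cn N (b * M) := hstep₁
      _ ≤ (n : ENNReal) ^ (k + 1) * ((n : ENNReal) * cn N M) := mul_le_mul_right hstep₂ _
      _ = (n : ENNReal) ^ (k + 1 + 1) * cn N M := by ring

/-- **Baire uniformisation with constants and thresholds, for an arbitrary function
`cn : ℕ → ℝ → ℝ≥0∞`.**  One-sided Baire on an interval + left lower-semicontinuity of every
`L ↦ cn(N, L)` + per-ratio retention (threshold `N₀(a)`, guard `η₀(a)`, factor `K(a)`) on an
open interval of ratios `(lo, hi) ⊂ (0, 1)` ⟹ uniform small-ratio retention: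
`∃ n a₀ > 0, ∀ a ∈ (0, a₀], ∃ K > 0, ∀ N ≥ n, ∀ M, (n+1)N < (aM)³ → cn(N, aM) ≤ K · cn(N, M)`.
[folklore] -/
theorem uniform (cn : ℕ → ℝ → ENNReal)
    (hBaire : ∀ (A : ℕ → Set ℝ) (lo hi : ℝ), lo < hi →
      (∀ a : ℝ, lo < a → a < hi → ∃ n : ℕ, a ∈ A n) →
      (∀ (n : ℕ) (a : ℝ), lo < a → a < hi →
        (∀ ε : ℝ, 0 < ε → ∃ b : ℝ, a - ε < b ∧ b < a ∧ b ∈ A n) → a ∈ A n) →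
      ∃ (n : ℕ) (a₁ a₂ : ℝ), lo ≤ a₁ ∧ a₁ < a₂ ∧ a₂ ≤ hi ∧ ∀ a : ℝ, a₁ ≤ a → a ≤ a₂ → a ∈ A n)
    (hLsc : ∀ (N : ℕ) (x : ℝ) (C : ENNReal), 0 < x →
      (∀ ε : ℝ, 0 < ε → ∃ x' : ℝ, x - ε < x' ∧ x' < x ∧ cn N x' ≤ C) → cn N x ≤ C)
    (hRet : ∃ lo hi : ℝ, 0 < lo ∧ lo < hi ∧ hi < 1 ∧ ∀ a : ℝ, lo < a → a < hi →
      ∃ (N₀ : ℕ) (η₀ K : ℝ), 0 < η₀ ∧ 0 < K ∧ ∀ (N : ℕ) (L : ℝ), N₀ ≤ N →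
        (N : ℝ) ≤ η₀ * L ^ 3 → cn N L ≤ ENNReal.ofReal K * cn N (L / a)) :
    ∃ (n : ℕ) (a₀ : ℝ), 0 < a₀ ∧ ∀ a : ℝ, 0 < a → a ≤ a₀ → ∃ K : ℝ, 0 < K ∧
      ∀ (N : ℕ) (M : ℝ), n ≤ N → ((n : ℝ) + 1) * N < (a * M) ^ 3 →
        cn N (a * M) ≤ ENNReal.ofReal K * cn N M := by
  obtain ⟨lo, hi, hlo, hlohi, hhi1, hret⟩ := hRet
  -- Baire on `A n := {a | ∀ N M, n ≤ N → (n+1)N < (aM)³ → cn N (aM) ≤ n * cn N M}`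
  obtain ⟨n, a₁, a₂, hloa₁, h₁₂, ha₂hi, hA⟩ := hBaire
    (fun n => {a : ℝ | ∀ (N : ℕ) (M : ℝ), n ≤ N → ((n : ℝ) + 1) * N < (a * M) ^ 3 →
      cn N (a * M) ≤ (n : ENNReal) * cn N M})
    lo hi hlohi
    (fun a hloa hahi => by
      obtain ⟨N₀, η₀, K, hη₀, _, hmono⟩ := hret a hloa hahi
      exact cover cn (hlo.trans hloa) hη₀ hmono)
    (fun n a hloa _ hleft => leftClosed cn hLsc n (hlo.trans hloa) hleft)
  have h₁ : 0 < a₁ := lt_of_lt_of_le hlo hloa₁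
  have h₂ : a₂ < 1 := lt_of_le_of_lt ha₂hi hhi1
  refine ⟨n, Real.exp (Real.log a₁ * Real.log a₂ / (Real.log a₁ - Real.log a₂)), Real.exp_pos _,
    fun a ha hale => ?_⟩
  obtain ⟨k, b, hb₁, hb₂, rfl⟩ := exists_root h₁ h₁₂ h₂ ha hale
  refine ⟨(n : ℝ) ^ (k + 1) + 1, by positivity, fun N M hnN hg => ?_⟩
  exact (pow_chain cn n h₁ h₂.le hA k b hb₁ hb₂ N M hnN hg).trans
    (mul_le_mul_left (natCast_pow_le_ofReal n (k + 1)) _)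

end SmallRatioMul

/-- **S6' — BAIRE UNIFORMISATION OF THE DILATION RATIO WITH CONSTANTS AND THRESHOLDS.**
One-sided Baire on an interval (S5) + left lower-semicontinuity of `L ↦ cn(HS₁, N, L)`
(conclusion of S4) + per-ratio retention on an open interval of ratios (S2: threshold `N₀(a)`,
dilute guard `η₀(a) > 0`, factor `K(a) > 0`) ⟹ UNIFORM small-ratio retention: there are `n` and
`a₀ > 0` such that every ratio `a ∈ (0, a₀]` has a factor `K > 0` with
`cn(HS₁, N, aM) ≤ K · cn(HS₁, N, M)` whenever `N ≥ n` and `(n+1)·N < (aM)³`.  (Fold `N₀(a)`,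
`1/η₀(a)` and `K(a)` into ONE index,
`A n := {a | ∀ N M, n ≤ N → (n+1)N < (aM)³ → cn(N, aM) ≤ n · cn(N, M)}`; cover and left closure
(level `C := n · cn(N, M)`) as for `stub_smallRatio_of`; S5 gives `[a₁, a₂] ⊆ A n`,
`0 < lo ≤ a₁ < a₂ ≤ hi < 1`; chains give `cn(N, bᵏ⁺¹M) ≤ nᵏ⁺¹ · cn(N, M)`; every `a ∈ (0, a₀]`,
`a₀ := exp (log a₁ · log a₂ / (log a₁ - log a₂))`, is `bᵏ⁺¹` with `b ∈ [a₁, a₂]`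
(`SmallRatio.exists_root`), so `K(a) := nᵏ⁺¹ + 1` works.)  The instance
`cn := condensateNumber HS₁` of `SmallRatioMul.uniform`. [folklore] -/
theorem stub_smallRatioMul_of :
    (∀ (A : ℕ → Set ℝ) (lo hi : ℝ), lo < hi → (∀ a : ℝ, lo < a → a < hi → ∃ n : ℕ, a ∈ A n) → (∀ (n : ℕ) (a : ℝ), lo < a → a < hi → (∀ ε : ℝ, 0 < ε → ∃ b : ℝ, a - ε < b ∧ b < a ∧ b ∈ A n) → a ∈ A n) → ∃ (n : ℕ) (a₁ a₂ : ℝ), lo ≤ a₁ ∧ a₁ < a₂ ∧ a₂ ≤ hi ∧ ∀ a : ℝ, a₁ ≤ a → a ≤ a₂ → a ∈ A n) →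
    (∀ (N : ℕ) (x : ℝ) (C : ENNReal), 0 < x → (∀ ε : ℝ, 0 < ε → ∃ x' : ℝ, x - ε < x' ∧ x' < x ∧ Literature.MathematicalPhysics.QuantumManyBody.BoseGas.condensateNumber (Set.indicator (Set.Iic 1) (fun _ : ℝ => (⊤ : ENNReal))) N x' ≤ C) → Literature.MathematicalPhysics.QuantumManyBody.BoseGas.condensateNumber (Set.indicator (Set.Iic 1) (fun _ : ℝ => (⊤ : ENNReal))) N x ≤ C) →
    (∃ lo hi : ℝ, 0 < lo ∧ lo < hi ∧ hi < 1 ∧ ∀ a : ℝ, lo < a → a < hi → ∃ (N₀ : ℕ) (η₀ K : ℝ), 0 < η₀ ∧ 0 < K ∧ ∀ (N : ℕ) (L : ℝ), N₀ ≤ N → (N : ℝ) ≤ η₀ * L ^ 3 → Literature.MathematicalPhysics.QuantumManyBody.BoseGas.condensateNumber (Set.indicator (Set.Iic 1) (fun _ : ℝ => (⊤ : ENNReal))) N L ≤ ENNReal.ofReal K * Literature.MathematicalPhysics.QuantumManyBody.BoseGas.condensateNumber (Set.indicator (Set.Iic 1) (fun _ : ℝ => (⊤ : ENNReal))) N (L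 / a)) →
    ∃ (n : ℕ) (a₀ : ℝ), 0 < a₀ ∧ ∀ a : ℝ, 0 < a → a ≤ a₀ → ∃ K : ℝ, 0 < K ∧ ∀ (N : ℕ) (M : ℝ), n ≤ N → ((n : ℝ) + 1) * N < (a * M) ^ 3 → Literature.MathematicalPhysics.QuantumManyBody.BoseGas.condensateNumber (Set.indicator (Set.Iic 1) (fun _ : ℝ => (⊤ : ENNReal))) N (a * M) ≤ ENNReal.ofReal K * Literature.MathematicalPhysics.QuantumManyBody.BoseGas.condensateNumber (Set.indicator (Set.Iic 1) (fun _ : ℝ => (⊤ : ENNReal))) N M :=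
  SmallRatioMul.uniform
    (Literature.MathematicalPhysics.QuantumManyBody.BoseGas.condensateNumber
      (Set.indicator (Set.Iic 1) (fun _ : ℝ => (⊤ : ENNReal))))

end Summit.AtomisticToContinuum.BoseEinsteinCondensation.Cruxes.HardSphereBEC.Birth
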